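import Literature.MathematicalPhysics.QuantumFieldTheory.Balaban1983to89.B9SectCDistCompare
import Literature.MathematicalPhysics.QuantumFieldTheory.Balaban1983to89.B7BlockGeometry

/-! # `Balaban1983to89.B9SectCDistCompareBlocks` — the IN-ZONE INSTANCE of the bond cover of `B9SectCDistCompare`:
# the block-corner map of B7 (2) sends every bond of spacing ≦ M of the fine lattice to a point or a unit bond of the
# M-times coarser lattice, so inside one global zone the local (□) multiscale distance dominates the global one with
# constant c = 1 (no loss of decay rate); kernel-checked, [folklore]

CITATION HEADER (lean-in-tree rule).  Paper sub-cell `b2b-balaban-b09` (gen 10, journal claim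
B9-SECTC-DISTCOMPARE-BLOCKS, cell pub-balaban) on T. Bałaban, *Propagators for lattice gauge theories in a background
field*, Commun. Math. Phys. **99** (1985) 389–434 [`Balaban1985BackgroundPropagators`] (= B9), Sect. C pp. 408–411
[PDF 20–23], with [4] = *Propagators and renormalization transformations for lattice gauge theories. II*, Commun. Math.
Phys. **96** (1984) 223–250 [`Balaban1984PropagatorsII`] (= B6), p. 231 [PDF 9], and [5] = *Averaging operations for
lattice gauge theories*, Commun. Math. Phys. **98** (1985) 17–51 [`Balaban1985Averaging`] (= B7), p. 17 [PDF 1]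
(renders `b2b-balaban-ref1/pages/1984-cmp96-propagators-rt-II/…-p009-x2.png` and `…/1985-cmp98-averaging/…-p001-x2.png`
READ AS IMAGES for this module; B9 pp. 408/409 renders `…/1985-cmp99-background-propagators/…-p020-x2.png`, `…-p021-x2.png` read as
images for the sibling `B9SectCDistCompare`, same seat).  SIBLINGS used by name, nothing restated: `B9SectCDistCompare`
(this lineage, gen 10: `BondCover`, `bondCover_one_of_adj_or_eq`, `BondCover.of_le/.comp/.dist_le`,
`dist_le_of_bondCover_one`, and the consumer edge `B9Eq395Transport.localizedExp_transport`), `B7BlockGeometry` (unit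
b07-g4: `blockMap_add_single_eq_or`, `blockMap_blockMap` over the tree's `QuantumLattice.BalabanRG.blockMap M x = ⌊x/M⌋`),
and the tree's nearest-neighbour graph `Probability.LatticeModels.zdGraph d` on `Fin d → ℤ` (= ℤ^d, the tree's `LatticeModels.Site d`).

WHAT IS PRINTED (verbatim).
* B7 p. 17, (1)–(3): *"A sequence of sets Ω^{(j)} is defined as the intersections Ω^{(j)} = Ω ∩ L^jηZ^d, (1) where L is
  a fixed integer, L > 1. For a point y ∈ L^nηZ^d (or any lattice δZ^d), we define a block of an order j as the cube
  B^j(y) = {x ∈ L^{−j}L^nηZ^d : y_μ ≦ x_μ < y_μ + L^nη, μ = 1, …, d} (2) (or the corresponding cube with L^nη replaced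
  by δ). … For a subset Λ ⊂ L^nηZ^d (or ⊂ δZ^d), we define B^j(Λ) = ⋃_{y∈Λ} B^j(y) ⊂ L^{−j}L^nηZ^d (or ⊂ L^{−j}δZ^d).
  (3)"*.
* B6 p. 231: *"For an arbitrary contour Γ on the lattice T_η we put |Γ| = nη, where n is a number of bonds the contour
  Γ consists of. We will define a new distance between two points of 𝔅. We consider a special class of contours Γ.
  They have the property that a part of Γ contained in B^j(Λ_j) consists of bonds of the lattice Λ_j. Now we define
  d(y, y′) = inf_{Γ_{y,y′}} Σ_{j=0}^k (L^jη)^{−1}|Γ_{y,y′} ∩ B^j(Λ_j)|, y, y′ ∈ 𝔅, (2.46) where the infimum is taken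
  over all admissible contours described above, with end-points, y, y′. We may extend this definition and define the
  distance for a pair of arbitrary points x, x′ ∈ T_η putting d(x, x′) = d(y^j(x), y^{j′}(x′)) if x ∈ B^j(Λ_j),
  x′ ∈ B^{j′}(Λ_{j′})."* — so every admissible bond of spacing L^jη inside B^j(Λ_j) contributes exactly 1 to (2.46):
  d counts admissible bonds (the tree's `B6Geometry.dist246` / `RealizedBy`), and points are compared through their
  block corners y^j(x).
* B9 p. 409 [PDF 21]: *"The operators constructed for this sequence, which we denote by G′_□(U), C_□(U) =
  (Q′(U)G′²_□(U)Q′*(U))^{−1}, G_□(U), satisfy all the inequalities of Theorems 3.1–3.3 correspondingly."* — the local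
  operators obey Theorem 3.2 with the distance (2.46) of the LOCAL sequence {Ω_n(□)} of p. 408, while (3.95)–(3.96),
  (3.132) are read on 𝔅 with the global d; the comparison between the two distances is not printed (cell records
  GAPS C-B9-54, DIVERGENCE D-b09.38 of the sibling).

WHY THIS FILE.  The sibling `B9SectCDistCompare` reduces the comparison to ONE combinatorial hypothesis
`BondCover G₁ G₂ φ m` (every admissible bond of the first contour system is covered by an admissible contour of ≦ m
bonds of the second between the φ-images), leaving the instance (φ, m) for Bałaban's systems as a located reading
(D-b09.38 (ii)).  THIS FILE makes the IN-ZONE half of that reading kernel.  SCALED COORDINATES as in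
`B7BlockGeometry`: inside one global zone B^{j′}(Λ_{j′}) take the fine unit so that all lattice points are integer
vectors (`Fin d → ℤ` = ℤ^d) and the global block lattice Λ_{j′} ⊂ L^{j′}ηℤ^d is Mℤ^d, identified with ℤ^d through the
block-corner map `blockMap M x = ⌊x/M⌋` (coordinatewise; = the corner y of the block B(y) ∋ x of (2), i.e. the map
x ↦ y^{j′}(x) of B6 p. 231).  A local admissible bond of the sequence {Ω_n(□)} lying in this zone joins x to
x + l·e_μ with spacing l = L^n; under the repaired reading R-∩ of p. 408 (Ω_n(□) := C_n(□) ∩ Ω_n, cell GAPS G-adv4-4)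
the local zone index there is ≦ j′, so 0 < l ≦ M — such bonds are edges of `axisGraph d M` below (ALL spacings
0 < l ≦ M, nestedness is not even needed).
* `blockMap_adj_or_eq_of_axisAdj` : the corners of the end-points of a bond of spacing 0 < l ≦ M are EQUAL or
  ADJACENT in the unit graph (`B7BlockGeometry.blockMap_add_single_eq_or`: ⌊(x_μ + l)/M⌋ ∈ {⌊x_μ/M⌋, ⌊x_μ/M⌋ + 1});
* `bondCover_blockMap_axis` / `bondCover_blockMap_of_le` / `bondCover_blockMap` : `BondCover H (zdGraph d) (blockMap M) 1`
  for every bond graph `H ≤ axisGraph d M` (in particular the unit graph itself), whence the contraction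
  `dist_blockMap_le` : d_{ℤ^d}(⌊x/M⌋, ⌊y/M⌋) ≦ d_{ℤ^d}(x, y), and the two-step consistency `bondCover_blockMap_comp`
  (nested blocks (3): ⌊⌊x/M⌋/K⌋ = ⌊x/(MK)⌋, `blockMap_blockMap`);
* REGIONS (zones are unions of blocks, (3): B^{j′}(Λ) = the preimage of Λ under the corner map): `bondCover_one_induce`
  (a cover by points-or-bonds restricts to induced subgraphs along any `Set.MapsTo`), `bondCover_blockMap_induce`,
  `bondCover_blockMap_preimage`, `dist_blockMap_le_induce`;
* CARRIERS: `dist_le_of_blockMap` — for two distances realized (`B6Geometry.RealizedBy`) by `H.induce A₁` (local block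
  points, fine units) and `(zdGraph d).induce A₂` (global block points, coarse units), block points a, b joined by a
  local admissible contour inside the region and identified points with matching corners: d(y, y′) ≦ d_□(a, b), i.e.
  the sibling's comparison with m = 1, c = 1; `hdist_of_blockMap` = the `hdist` binder of
  `B9Eq395Transport.localizedExp_transport` with c = 1; and the glued edge `localizedExp_transport_of_blockMap`: for a
  cube □ whose whole local carrier lies inside ONE global zone the localized majorant 1_S(b)·Θ·e^{−ρδ₀d_□(a,b)}
  transports to 1_{S′}(y′)·Θ·e^{−ρδ₀d(y,y′)} with the SAME rate.
BOUNDARY.  Not asserted: that Bałaban's local/global block lattices, zones and embeddings satisfy the hypotheses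
(`H ≤ axisGraph d M` = local spacings ≦ the global one on the region, `Set.MapsTo` = the region is a union of global
blocks, `RealizedBy` ×2 = the (2.46) realizations, `hcompat` = identified block points have the same corner block,
reachability inside the region); and NOTHING about local bonds meeting a global surface Σ_{j′} (end-points in different
global zones) — the ACROSS-SURFACE half of D-b09.38 (ii) (m = O(dL) there) stays located, not kernel.  No estimate of
the paper is asserted.  [folklore] = finite lattice geometry; value = kernel-checked bookkeeping, NOT summit progress.
Cell records: GAPS C-B9-55, DIVERGENCE D-b09.38-add1. -/

namespace Literature.MathematicalPhysics.QuantumFieldTheory.Balaban1983to89.B9SectCDistCompareBlocks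

open Literature.Probability.LatticeModels (zdGraph zdGraph_adj_iff zdGraph_reachable)
open Literature.MathematicalPhysics.QuantumLattice (blockMap)
open B7BlockGeometry B9SectCDistCompare B9Eq395Transport

variable {d : ℕ}

/-! ## §1  Bonds of all spacings `0 < l ≤ M` along the axes, and the corner map on them -/

/-- The graph on ℤ^d whose bonds are the pairs ⟨x, x + l·e_μ⟩, 0 < l ≦ M: it contains every admissible bond of a block
lattice of spacing L^n ≦ M = L^{j′} drawn in the fine unit (B7 (1)–(2): the lattices L^jηZ^d ⊂ ηZ^d). [folklore] -/
def axisGraph (d M : ℕ) : SimpleGraph (Fin d → ℤ) :=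
  SimpleGraph.fromRel fun x y => ∃ (μ : Fin d) (l : ℤ), 0 < l ∧ l ≤ M ∧ y = x + Pi.single μ l

/-- Unit bonds are bonds of spacing 1 ≦ M. [folklore] -/
theorem zdGraph_le_axisGraph (M : ℕ) (hM : 0 < M) : zdGraph d ≤ axisGraph d M := by
  intro x y h
  have hne : x ≠ y := h.ne
  simp only [axisGraph, SimpleGraph.fromRel_adj]
  refine ⟨hne, ?_⟩
  obtain ⟨μ, h1 | h1⟩ := (zdGraph_adj_iff x y).1 h
  · exact Or.inl ⟨μ, 1, zero_lt_one, by omega, h1⟩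
  · exact Or.inr ⟨μ, 1, zero_lt_one, by omega, h1⟩

/-- Larger spacing bound, more bonds. [folklore] -/
theorem axisGraph_mono {M M' : ℕ} (h : M ≤ M') : axisGraph d M ≤ axisGraph d M' := by
  intro x y hxy
  simp only [axisGraph, SimpleGraph.fromRel_adj] at hxy ⊢
  obtain ⟨hne, hr⟩ := hxy
  refine ⟨hne, ?_⟩
  have hMM : (M : ℤ) ≤ M' := by exact_mod_cast h
  rcases hr with ⟨μ, l, h0, hl, he⟩ | ⟨μ, l, h0, hl, he⟩
  · exact Or.inl ⟨μ, l, h0, hl.trans hMM, he⟩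
  · exact Or.inr ⟨μ, l, h0, hl.trans hMM, he⟩

/-- **The corner map sends a bond of spacing 0 < l ≦ M to a point or a unit bond** (B7 (2): the corners
y^{j′}(x), y^{j′}(x + l e_μ) of the M-blocks containing the end-points are equal or differ by M e_μ, i.e. by e_μ in the
coarse unit; `B7BlockGeometry.blockMap_add_single_eq_or`). [cite: Balaban1985Averaging, (2) p.17] -/
theorem blockMap_adj_or_eq_of_axisAdj (M : ℕ) (hM : 0 < M) {x y : Fin d → ℤ} (h : (axisGraph d M).Adj x y) :
    blockMap M x = blockMap M y ∨ (zdGraph d).Adj (blockMap M x) (blockMap M y) := by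
  simp only [axisGraph, SimpleGraph.fromRel_adj] at h
  obtain ⟨-, ⟨μ, l, hl0, hlM, rfl⟩ | ⟨μ, l, hl0, hlM, rfl⟩⟩ := h
  · rcases blockMap_add_single_eq_or M hM x μ hl0.le hlM with h0 | h1
    · exact Or.inl h0.symm
    · exact Or.inr ((zdGraph_adj_iff _ _).2 ⟨μ, Or.inl h1⟩)
  · rcases blockMap_add_single_eq_or M hM y μ hl0.le hlM with h0 | h1
    · exact Or.inl h0
    · exact Or.inr ((zdGraph_adj_iff _ _).2 ⟨μ, Or.inr h1⟩)

/-- The same for a unit bond. [cite: Balaban1985Averaging, (2) p.17] -/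
theorem blockMap_adj_or_eq (M : ℕ) (hM : 0 < M) {x y : Fin d → ℤ} (h : (zdGraph d).Adj x y) :
    blockMap M x = blockMap M y ∨ (zdGraph d).Adj (blockMap M x) (blockMap M y) :=
  blockMap_adj_or_eq_of_axisAdj M hM (zdGraph_le_axisGraph M hM h)

/-! ## §2  The bond covers with constant 1 -/

/-- **The corner map is a bond cover with constant 1** from the bonds of all spacings ≦ M to the unit bonds of the
coarse lattice (in its own unit). [cite: Balaban1985Averaging, (2) p.17; Balaban1984PropagatorsII, (2.46) p.231] -/
theorem bondCover_blockMap_axis (M : ℕ) (hM : 0 < M) : BondCover (axisGraph d M) (zdGraph d) (blockMap M) 1 :=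
  bondCover_one_of_adj_or_eq fun _ _ h => blockMap_adj_or_eq_of_axisAdj M hM h

/-- … hence from every bond graph H drawn from those bonds (the local admissible bonds inside one global zone, local
spacings L^n ≦ M). [cite: Balaban1985Averaging, (2) p.17; Balaban1984PropagatorsII, (2.46) p.231] -/
theorem bondCover_blockMap_of_le (M : ℕ) (hM : 0 < M) {H : SimpleGraph (Fin d → ℤ)} (hH : H ≤ axisGraph d M) :
    BondCover H (zdGraph d) (blockMap M) 1 :=
  (bondCover_blockMap_axis M hM).of_le hH le_rfl

/-- … in particular from the unit graph of the fine lattice. [cite: Balaban1985Averaging, (2) p.17] -/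
theorem bondCover_blockMap (M : ℕ) (hM : 0 < M) : BondCover (zdGraph d) (zdGraph d) (blockMap M) 1 :=
  bondCover_blockMap_of_le M hM (zdGraph_le_axisGraph M hM)

/-- **The corner map contracts graph distance**: d_{ℤ^d}(⌊x/M⌋, ⌊y/M⌋) ≦ d_{ℤ^d}(x, y). [folklore] -/
theorem dist_blockMap_le (M : ℕ) (hM : 0 < M) (x y : Fin d → ℤ) :
    (zdGraph d).dist (blockMap M x) (blockMap M y) ≤ (zdGraph d).dist x y := by
  simpa using (bondCover_blockMap (d := d) M hM).dist_le (zdGraph_reachable x y)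

/-- Nested blocks, B7 (3)/p. 17: coarsening by M and then by K is coarsening by MK. [cite: Balaban1985Averaging, (3) p.17] -/
theorem blockMap_comp_blockMap (M K : ℕ) : (blockMap K ∘ blockMap M : (Fin d → ℤ) → (Fin d → ℤ)) = blockMap (M * K) :=
  funext fun x => blockMap_blockMap M K x

/-- Two-step consistency: the composite of the covers at ratios M and K is the cover at ratio MK, still with
constant 1·1 = 1 (`BondCover.comp`). [cite: Balaban1985Averaging, (3) p.17] -/
theorem bondCover_blockMap_comp (M K : ℕ) (hM : 0 < M) (hK : 0 < K) :
    BondCover (axisGraph d M) (zdGraph d) (blockMap (M * K)) 1 := by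
  have h := (bondCover_blockMap_axis (d := d) M hM).comp (bondCover_blockMap (d := d) K hK)
  rwa [blockMap_comp_blockMap, mul_one] at h

/-! ## §3  Regions: zones are unions of blocks -/

/-- A cover by points-or-bonds restricts to INDUCED subgraphs along any `Set.MapsTo` (the intermediate contour has no
interior vertex to keep inside the region). [folklore] -/
theorem bondCover_one_induce {V₁ V₂ : Type*} {G₁ : SimpleGraph V₁} {G₂ : SimpleGraph V₂} {φ : V₁ → V₂}
    (h : ∀ ⦃u v : V₁⦄, G₁.Adj u v → φ u = φ v ∨ G₂.Adj (φ u) (φ v)) {A₁ : Set V₁} {A₂ : Set V₂}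
    (hA : Set.MapsTo φ A₁ A₂) :
    BondCover (G₁.induce A₁) (G₂.induce A₂) (Set.MapsTo.restrict φ A₁ A₂ hA) 1 :=
  bondCover_one_of_adj_or_eq fun u v huv => by
    rcases h (SimpleGraph.induce_adj.1 huv) with h0 | h1
    · exact Or.inl (Subtype.ext (by simpa using h0))
    · exact Or.inr (SimpleGraph.induce_adj.2 (by simpa using h1))

/-- **In-zone cover**: local admissible bonds (spacings ≦ M) among the points of a region A₁ are covered, with constant 1,
by points-or-unit-bonds of the coarse lattice among the corners A₂, provided the corner map carries A₁ into A₂.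
[cite: Balaban1985Averaging, (2)–(3) p.17; Balaban1984PropagatorsII, (2.46) p.231; Balaban1985BackgroundPropagators, p.409] -/
theorem bondCover_blockMap_induce (M : ℕ) (hM : 0 < M) {H : SimpleGraph (Fin d → ℤ)} (hH : H ≤ axisGraph d M)
    {A₁ A₂ : Set (Fin d → ℤ)} (hA : Set.MapsTo (blockMap M) A₁ A₂) :
    BondCover (H.induce A₁) ((zdGraph d).induce A₂) (Set.MapsTo.restrict (blockMap M) A₁ A₂ hA) 1 :=
  bondCover_one_induce (fun _ _ h => blockMap_adj_or_eq_of_axisAdj M hM (hH h)) hA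

/-- The case of a region which IS a union of coarse blocks, A₁ = the corner-preimage of A₂ (B7 (3):
B^{j′}(Λ) = ⋃_{y∈Λ} B^{j′}(y)). [cite: Balaban1985Averaging, (3) p.17] -/
theorem bondCover_blockMap_preimage (M : ℕ) (hM : 0 < M) {H : SimpleGraph (Fin d → ℤ)} (hH : H ≤ axisGraph d M)
    (A : Set (Fin d → ℤ)) :
    BondCover (H.induce (blockMap M ⁻¹' A)) ((zdGraph d).induce A)
      (Set.MapsTo.restrict (blockMap M) (blockMap M ⁻¹' A) A (Set.mapsTo_preimage (blockMap M) A)) 1 :=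
  bondCover_blockMap_induce M hM hH (Set.mapsTo_preimage _ _)

/-- Distance contraction inside a region, for points joined by a local contour inside it. [folklore] -/
theorem dist_blockMap_le_induce (M : ℕ) (hM : 0 < M) {H : SimpleGraph (Fin d → ℤ)} (hH : H ≤ axisGraph d M)
    {A₁ A₂ : Set (Fin d → ℤ)} (hA : Set.MapsTo (blockMap M) A₁ A₂) {a b : A₁} (hab : (H.induce A₁).Reachable a b) :
    ((zdGraph d).induce A₂).dist (Set.MapsTo.restrict (blockMap M) A₁ A₂ hA a)
        (Set.MapsTo.restrict (blockMap M) A₁ A₂ hA b) ≤ (H.induce A₁).dist a b := by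
  simpa using (bondCover_blockMap_induce M hM hH hA).dist_le hab

/-! ## §4  Carriers: the comparison d ≦ d_□ with c = 1 and the transported majorant with the same rate -/

section Carriers

variable {S₁ S₂ : Type*} {dist₁ : S₁ → S₁ → ℝ} {dist₂ : S₂ → S₂ → ℝ} {M : ℕ} {H : SimpleGraph (Fin d → ℤ)}
  {A₁ A₂ : Set (Fin d → ℤ)} {ι₁ : S₁ → A₁} {ι₂ : S₂ → A₂}

/-- **d(y, y′) ≦ d_□(a, b) inside one global zone**: the local distance (2.46) realized by the local admissible bonds
H among the region's points A₁ (fine unit) dominates the global distance (2.46) realized by the unit bonds among the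
corners A₂ (coarse unit), for local block points a, b joined by a local contour inside the region and global block
points y, y′ whose points are the corners of a, b. [cite: Balaban1984PropagatorsII, (2.46) p.231;
Balaban1985BackgroundPropagators, p.409 + p.411] -/
theorem dist_le_of_blockMap (hM : 0 < M) (hH : H ≤ axisGraph d M) (hA : Set.MapsTo (blockMap M) A₁ A₂)
    (h₁ : B6Geometry.RealizedBy dist₁ (H.induce A₁) ι₁) (h₂ : B6Geometry.RealizedBy dist₂ ((zdGraph d).induce A₂) ι₂)
    {a b : S₁} (hreach : (H.induce A₁).Reachable (ι₁ a) (ι₁ b)) {y y' : S₂}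
    (ha : blockMap M (ι₁ a : Fin d → ℤ) = (ι₂ y : Fin d → ℤ)) (hb : blockMap M (ι₁ b : Fin d → ℤ) = (ι₂ y' : Fin d → ℤ)) :
    dist₂ y y' ≤ dist₁ a b :=
  dist_le_of_bondCover_one h₁ h₂ (bondCover_blockMap_induce M hM hH hA) hreach (Subtype.ext (by simpa using ha))
    (Subtype.ext (by simpa using hb))

/-- **The `hdist` binder of `B9Eq395Transport.localizedExp_transport` with c = 1**, for a local system whose whole
carrier lies inside one global zone (all local block points joined inside the region) and embeddings e₁, e₂ into a
common index set identifying points with matching corners. [cite: Balaban1985BackgroundPropagators, p.409 + (3.95) p.411;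
Balaban1984PropagatorsII, (2.46) p.231] -/
theorem hdist_of_blockMap {X : Type*} (hM : 0 < M) (hH : H ≤ axisGraph d M) (hA : Set.MapsTo (blockMap M) A₁ A₂)
    (h₁ : B6Geometry.RealizedBy dist₁ (H.induce A₁) ι₁) (h₂ : B6Geometry.RealizedBy dist₂ ((zdGraph d).induce A₂) ι₂)
    (hreach : ∀ a b : S₁, (H.induce A₁).Reachable (ι₁ a) (ι₁ b)) {e₁ : S₁ → X} {e₂ : S₂ → X}
    (hcompat : ∀ a y, e₁ a = e₂ y → blockMap M (ι₁ a : Fin d → ℤ) = (ι₂ y : Fin d → ℤ)) :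
    ∀ a b y y', e₁ a = e₂ y → e₁ b = e₂ y' → 1 * dist₂ y y' ≤ dist₁ a b :=
  fun a b y y' ha hb => by
    rw [one_mul]
    exact dist_le_of_blockMap hM hH hA h₁ h₂ (hreach a b) (hcompat a y ha) (hcompat b y' hb)

end Carriers

section Edge

/-- **Transport of the localized exponential majorant with the SAME rate** (B9 p. 409 read on 𝔅, (3.95) p. 411): for a
cube □ whose local carrier lies inside one global zone — local admissible bonds `H ≤ axisGraph d M` among the region
A₁, global unit bonds among the corners A₂, `RealizedBy` ×2, matching corners on identified points — the tree's
`localizedExp_transport` with c = 1: a majorant 1_S(b)·Θ·e^{−ρδ₀d_□(a,b)} of A on ℝ^{𝔅(□)} yields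
1_{S′}(y′)·Θ·e^{−ρδ₀d(y,y′)} for `compress e₂ (dilate e₁ A)` on ℝ^{𝔅}.  Whether a given □ is in this case, and the
across-surface case, are NOT asserted (module docstring). [cite: Balaban1985BackgroundPropagators, p.409 + (3.95) p.411;
Balaban1984PropagatorsII, (2.46) p.231 + (2.85) p.238; Balaban1985Averaging, (2) p.17] -/
theorem localizedExp_transport_of_blockMap {X : Type} {g₁ g₂ : B9.Geometry} [Fintype g₁.Site]
    [DecidableEq g₁.Site] [Fintype g₂.Site] [DecidableEq g₂.Site] [DecidableEq X] {R₁ R₂ : ℝ} {H₁ H₂ : Prop}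
    {e₁ : g₁.Site → X} {e₂ : g₂.Site → X} (he₁ : Function.Injective e₁) (he₂ : Function.Injective e₂)
    (Θ ρ δ₀ : ℝ) (hΘ : 0 ≤ Θ) (hρ : 0 ≤ ρ) (hδ₀ : 0 ≤ δ₀) (S₁ : Finset g₁.Site) (S₂ : Finset g₂.Site)
    (hS : ∀ b y', e₁ b = e₂ y' → b ∈ S₁ → y' ∈ S₂)
    {M : ℕ} (hM : 0 < M) {H : SimpleGraph (Fin d → ℤ)} (hH : H ≤ axisGraph d M) {A₁ A₂ : Set (Fin d → ℤ)}
    (hA : Set.MapsTo (blockMap M) A₁ A₂) {ι₁ : g₁.Site → A₁} {ι₂ : g₂.Site → A₂}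
    (h₁ : B6Geometry.RealizedBy g₁.dist (H.induce A₁) ι₁) (h₂ : B6Geometry.RealizedBy g₂.dist ((zdGraph d).induce A₂) ι₂)
    (hreach : ∀ a b, (H.induce A₁).Reachable (ι₁ a) (ι₁ b))
    (hcompat : ∀ a y, e₁ a = e₂ y → blockMap M (ι₁ a : Fin d → ℤ) = (ι₂ y : Fin d → ℤ))
    {A : Module.End ℝ (g₁.Site → ℝ)}
    (hAm : B6RandomWalk.HasMajorant (g := B9Thm34Ext.toB6 g₁ R₁ H₁) (fun x : g₁.Site => x) A
      (fun (a b : g₁.Site) => (if b ∈ S₁ then (1 : ℝ) else 0) * Θ * Real.exp (-(ρ * δ₀ * g₁.dist a b)))) :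
    B6RandomWalk.HasMajorant (g := B9Thm34Ext.toB6 g₂ R₂ H₂) (fun x : g₂.Site => x) (compress e₂ (dilate e₁ A))
      (fun (y y' : g₂.Site) => (if y' ∈ S₂ then (1 : ℝ) else 0) * Θ *
        Real.exp (-(ρ * δ₀ * g₂.dist y y'))) := by
  have h := localizedExp_transport (R₁ := R₁) (R₂ := R₂) (H₁ := H₁) (H₂ := H₂) he₁ he₂ Θ ρ δ₀ 1 hΘ hρ hδ₀ S₁ S₂
    hS (hdist_of_blockMap hM hH hA h₁ h₂ hreach hcompat) hAm
  simp only [one_mul] at h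
  exact h

end Edge

end Literature.MathematicalPhysics.QuantumFieldTheory.Balaban1983to89.B9SectCDistCompareBlocks
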